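import Literature.AlgebraicGeometry.Resolution.InitialFormLinearFactors
import Mathlib.FieldTheory.IsAlgClosed.Basic
import Mathlib.RingTheory.LocalRing.ResidueField.Basic
import Mathlib.Data.ZMod.Basic
import Mathlib.FieldTheory.Finite.Basic
import HarnessLib

/-!
# Steer (Par-S) brick #3 — the ARITHMETIC vocabulary of the binary residue: `HasRootlessPoly κ d`, binary forms without
# zeros on `κ² ∖ 0`, and their absence over an algebraically closed residue field (the emptiness of K4♯ over `k = k̄`)

OURS — campaign `res-hironaka`, rung L ★L-G4, slot W4.1, crux `Steer` (stmt-ResolutionOfSingularities-16345), piece (Par-S) of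
res-L0-w41-plan-1 RULING 115 (2026-08-27T12:03:36Z, (115a) brick #3 «ARITH VOCABULARY») re-dealt to this seat by RULING 120 (120b,
12:28:31Z); source texts: res-L0-w41-tri-1 g5 `L/res-L0-w41-tri-1/v610/ArithResidue.lean` (sha16 e823b15837078c7e; card 7 addendum g8 of
res-L0-w41-idea-1, TRIAGE v6.10) RE-HOMED VERBATIM (`HasRootlessPoly`, `not_hasRootlessPoly_of_isAlgClosed`, `hasRootlessPoly_zmod2_three`),
and the A7 clause text `v610/ArithWord.lean` (53185a2f9b17b242) = res-L0-w41-strat-2 (g0) `ArithBinaryResidueAt`, whose LAST CONJUNCT reads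
«`∀ a b : ResidueField (R i), (a ≠ 0 ∨ b ≠ 0) → MvPolynomial.eval ![a, b] (MvPolynomial.map (residue (R i)) Ψ) ≠ 0`» for a form
`Ψ : MvPolynomial (Fin 2) (R i)` homogeneous of degree `d` (the cleaned tangent form is BINARY without `κ_i`-linear factor).

## What is proved (pure algebra; Theses-free; no `instance`, no notation)

* `HasRootlessPoly κ d` (REAL definition, tri-1 verbatim): `κ` carries a one-variable polynomial of degree exactly `d` with no root in `κ`;
  `not_hasRootlessPoly_of_isAlgClosed` (fails over algebraically closed `κ` for `1 ≤ d`); `hasRootlessPoly_zmod2_three` (`X³ + X + 1` over `𝔽₂`).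
* `eval_left_of_isHomogeneous` / `eval_right_of_isHomogeneous` / `eval_one_zero_of_isHomogeneous` — for a binary form `Ψ` of degree `d`,
  `Ψ(a, 0) = coeff_{X₀^d} · a^d`, `Ψ(0, b) = coeff_{X₁^d} · b^d`;
  `hasRootlessPoly_of_forall_eval_ne_zero` — **a binary form of degree `d` over `κ` with NO ZERO on `κ² ∖ 0` dehomogenises
  (tree `Literature…Resolution.dehomLine` / `eval_dehomLine`, cited not restated) to a polynomial of degree exactly `d` without root:
  `HasRootlessPoly κ d`**.
* `exists_eval_eq_zero_of_isAlgClosed` — **over an algebraically closed field every binary form of degree `d ≥ 1` has a zero on `κ² ∖ 0`**;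
  `not_forall_eval_map_residue_ne_zero` — the same in the SHAPE of the A7 clause: for a local ring `S` with algebraically closed residue
  field and `Ψ : MvPolynomial (Fin 2) S` homogeneous of degree `d ≥ 1`, the last conjunct of `ArithBinaryResidueAt` is FALSE — the
  emptiness of the K4♯ residue over `k = k̄` once «`ZeroDim` ⇒ `κ_i` algebraic over `k`» supplies the instance (not this file).
* `eval_eq_zero_of_linear_dvd` / `linear_dvd_of_eval_eq_zero` — **for binary forms over a field «has a `κ`-linear factor» ⟺ «has a
  zero on `κ² ∖ 0`»** (factor theorem: a zero `(a, b) ≠ 0` gives the factor `b X₀ − a X₁`, by an invertible linear change of variables and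
  Mathlib's `mem_ideal_span_X_image`); hence `hasRootlessPoly_of_forall_not_linear_dvd` (RULING 115a verbatim «binary `d`-form without
  `κ`-linear factor ⇒ `HasRootlessPoly κ d`») and `exists_linear_dvd_of_isAlgClosed` («`IsAlgClosed κ`, `1 ≤ d` ⇒ every binary `d`-form
  has a `κ`-linear factor»);
  `exists_forall_eval_ne_zero_zmod2_three` — over `𝔽₂` the binary cubic `X₀³ + X₀X₁² + X₁³` has no zero on `𝔽₂² ∖ 0`: the side
  condition is genuinely ARITHMETIC (satisfiable over non-closed residue fields).

HONEST FRAMING. Elementary algebra of polynomials; every statement here is OURS (vocabulary and sanity lemmas for the words of record of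
W4.1), candidates' plumbing, not facts about resolution of singularities; nothing here is a statement of H. Hironaka's manuscript
[Hironaka2017] or of any cited source; AI-produced and AI-checked only, weaker than expert review. Classical context (not a premise):
binary forms over a field factor into linear forms over the algebraic closure [cite: Lang2002, Ch. IV §1].
-/

noncomputable section

set_option linter.dupNamespace false -- mandated namespace of this single-conjunct summit

open Polynomial IsLocalRing

namespace Summit.ResolutionOfSingularities.ResolutionOfSingularities.Theorems.SwitchingDichotomy.ArithResidue

open Literature.AlgebraicGeometry.Resolution

universe u

/-! ## 1. `HasRootlessPoly` (res-L0-w41-tri-1 `v610/ArithResidue.lean`, re-homed verbatim) -/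

/-- [OURS · W4.1 (Par-S) #3] (REAL definition, tri-1 verbatim) `κ` carries a polynomial of degree exactly `d` with no root in `κ` —
equivalently a binary form of degree `d` over `κ` with no `κ`-linear factor (the side condition of the binary residue at a stage with
residue field `κ`). NOT a statement of the manuscript. [folklore] -/
def HasRootlessPoly (κ : Type*) [Field κ] (d : ℕ) : Prop :=
  ∃ ψ : κ[X], ψ.natDegree = d ∧ ∀ a : κ, ¬ ψ.IsRoot a

/-- Over an algebraically closed field there is no such polynomial in any positive degree: the binary residue is empty there
(tri-1 verbatim). [folklore] -/
theorem not_hasRootlessPoly_of_isAlgClosed (κ : Type*) [Field κ] [IsAlgClosed κ] {d : ℕ} (hd : 1 ≤ d) :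
    ¬ HasRootlessPoly κ d := by
  rintro ⟨ψ, hdeg, hroot⟩
  have hψ : ψ.degree ≠ 0 := by
    intro h0
    have h := Polynomial.natDegree_eq_zero_iff_degree_le_zero.mpr (le_of_eq h0)
    omega
  obtain ⟨a, ha⟩ := IsAlgClosed.exists_root ψ hψ
  exact hroot a ha

/-- Conversely the condition is genuinely arithmetic: over `ZMod 2` the cubic `X³ + X + 1` has no root (tri-1 verbatim; so the
irreducible binary cubic `Z³ + Z W² + W³` is available over `𝔽₂`). [folklore] -/
theorem hasRootlessPoly_zmod2_three : HasRootlessPoly (ZMod 2) 3 := by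
  refine ⟨X ^ 3 + X + 1, ?_, ?_⟩
  · compute_degree!
  · intro a
    fin_cases a <;> simp [Polynomial.IsRoot] <;> decide

/-! ## 2. Binary forms: the value at `(1, 0)`, and «no zero on `κ² ∖ 0` ⇒ `HasRootlessPoly κ d`» -/

section Binary

variable {κ : Type u} [Field κ]

/-- For a binary form `Ψ` of degree `d`, `Ψ(a, 0) = coeff_{X₀^d}(Ψ) · a^d` (`X₀^d = lineExp d d`). [folklore] -/
theorem eval_left_of_isHomogeneous {Ψ : MvPolynomial (Fin 2) κ} {d : ℕ} (hΨ : Ψ.IsHomogeneous d) (a : κ) :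
    MvPolynomial.eval ![a, 0] Ψ = Ψ.coeff (lineExp d d) * a ^ d := by
  classical
  rw [MvPolynomial.eval_eq', Finset.sum_eq_single (lineExp d d)]
  · rw [Fin.prod_univ_two]
    simp
  · intro m hm hne
    have hdeg : m 0 + m 1 = d := by
      rw [← weight_one_fin_two]; exact hΨ (MvPolynomial.mem_support_iff.mp hm)
    have hm1 : m 1 ≠ 0 := by
      intro h0
      apply hne
      obtain ⟨-, heq⟩ := eq_lineExp_of_degree hdeg
      have hm0 : m 0 = d := by omega
      rw [hm0] at heq
      exact heq
    rw [Fin.prod_univ_two]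
    simp [hm1]
  · intro hnot
    rw [MvPolynomial.notMem_support_iff.mp hnot, zero_mul]

/-- For a binary form `Ψ` of degree `d`, `Ψ(0, b) = coeff_{X₁^d}(Ψ) · b^d` (`X₁^d = lineExp d 0`). [folklore] -/
theorem eval_right_of_isHomogeneous {Ψ : MvPolynomial (Fin 2) κ} {d : ℕ} (hΨ : Ψ.IsHomogeneous d) (b : κ) :
    MvPolynomial.eval ![0, b] Ψ = Ψ.coeff (lineExp d 0) * b ^ d := by
  classical
  rw [MvPolynomial.eval_eq', Finset.sum_eq_single (lineExp d 0)]
  · rw [Fin.prod_univ_two]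
    simp
  · intro m hm hne
    have hdeg : m 0 + m 1 = d := by
      rw [← weight_one_fin_two]; exact hΨ (MvPolynomial.mem_support_iff.mp hm)
    have hm0 : m 0 ≠ 0 := by
      intro h0
      apply hne
      obtain ⟨-, heq⟩ := eq_lineExp_of_degree hdeg
      rw [h0] at heq
      exact heq
    rw [Fin.prod_univ_two]
    simp [hm0]
  · intro hnot
    rw [MvPolynomial.notMem_support_iff.mp hnot, zero_mul]

/-- For a binary form `Ψ` of degree `d`, `Ψ(1, 0)` is the coefficient of `X₀^d`. [folklore] -/
theorem eval_one_zero_of_isHomogeneous {Ψ : MvPolynomial (Fin 2) κ} {d : ℕ} (hΨ : Ψ.IsHomogeneous d) :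
    MvPolynomial.eval ![1, 0] Ψ = Ψ.coeff (lineExp d d) := by
  rw [eval_left_of_isHomogeneous hΨ, one_pow, mul_one]

/-- **A binary form of degree `d` with no zero on `κ² ∖ 0` yields `HasRootlessPoly κ d`**: its dehomogenisation `ψ(t) = Ψ(t, 1)`
(tree `dehomLine`) has no root (`Ψ(a, 1) ≠ 0`) and degree exactly `d` (its `d`-th coefficient is `Ψ(1, 0) ≠ 0`). [folklore] -/
theorem hasRootlessPoly_of_forall_eval_ne_zero {Ψ : MvPolynomial (Fin 2) κ} {d : ℕ} (hΨ : Ψ.IsHomogeneous d)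
    (h : ∀ a b : κ, (a ≠ 0 ∨ b ≠ 0) → MvPolynomial.eval ![a, b] Ψ ≠ 0) : HasRootlessPoly κ d := by
  refine ⟨dehomLine d Ψ, le_antisymm (natDegree_dehomLine_le d Ψ) (Polynomial.le_natDegree_of_ne_zero ?_), fun a ha => ?_⟩
  · rw [coeff_dehomLine d Ψ d le_rfl, ← eval_one_zero_of_isHomogeneous hΨ]
    exact h 1 0 (Or.inl one_ne_zero)
  · rw [Polynomial.IsRoot.def, eval_dehomLine hΨ] at ha
    exact h a 1 (Or.inr one_ne_zero) ha

/-- **Over an algebraically closed field every binary form of degree `d ≥ 1` has a zero on `κ² ∖ 0`.** [folklore] -/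
theorem exists_eval_eq_zero_of_isAlgClosed [IsAlgClosed κ] {d : ℕ} (hd : 1 ≤ d) {Ψ : MvPolynomial (Fin 2) κ}
    (hΨ : Ψ.IsHomogeneous d) : ∃ a b : κ, (a ≠ 0 ∨ b ≠ 0) ∧ MvPolynomial.eval ![a, b] Ψ = 0 := by
  by_contra hne
  exact not_hasRootlessPoly_of_isAlgClosed κ hd
    (hasRootlessPoly_of_forall_eval_ne_zero hΨ fun a b hab h0 => hne ⟨a, b, hab, h0⟩)

/-- The same as a negation: «no zero on `κ² ∖ 0`» FAILS for every binary form of degree `d ≥ 1` over an algebraically closed field.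
[folklore] -/
theorem not_forall_eval_ne_zero_of_isAlgClosed [IsAlgClosed κ] {d : ℕ} (hd : 1 ≤ d) {Ψ : MvPolynomial (Fin 2) κ}
    (hΨ : Ψ.IsHomogeneous d) : ¬ ∀ a b : κ, (a ≠ 0 ∨ b ≠ 0) → MvPolynomial.eval ![a, b] Ψ ≠ 0 := fun h => by
  obtain ⟨a, b, hab, h0⟩ := exists_eval_eq_zero_of_isAlgClosed hd hΨ
  exact h a b hab h0

end Binary

/-! ## 3. The A7-clause shape: residue forms over a local ring with algebraically closed residue field -/

/-- **Emptiness of the arithmetic binary residue over an algebraically closed residue field**, in the shape of the last conjunct of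
strat-2's (g0) `ArithBinaryResidueAt`: for a local ring `S` whose residue field is algebraically closed and a form
`Ψ : MvPolynomial (Fin 2) S` homogeneous of degree `d ≥ 1`, it is FALSE that the residue form `Ψ̄` has no zero on `κ² ∖ 0`. [folklore] -/
theorem not_forall_eval_map_residue_ne_zero (S : Type u) [CommRing S] [IsLocalRing S] [IsAlgClosed (ResidueField S)]
    {d : ℕ} (hd : 1 ≤ d) {Ψ : MvPolynomial (Fin 2) S} (hΨ : Ψ.IsHomogeneous d) :
    ¬ ∀ a b : ResidueField S, (a ≠ 0 ∨ b ≠ 0) →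
      MvPolynomial.eval ![a, b] (MvPolynomial.map (residue S) Ψ) ≠ 0 :=
  not_forall_eval_ne_zero_of_isAlgClosed hd (hΨ.map (residue S))

/-- Positive form: the residue form of a binary form of degree `d ≥ 1` over a local ring with algebraically closed residue field HAS a
zero on `κ² ∖ 0`. [folklore] -/
theorem exists_eval_map_residue_eq_zero (S : Type u) [CommRing S] [IsLocalRing S] [IsAlgClosed (ResidueField S)]
    {d : ℕ} (hd : 1 ≤ d) {Ψ : MvPolynomial (Fin 2) S} (hΨ : Ψ.IsHomogeneous d) :
    ∃ a b : ResidueField S, (a ≠ 0 ∨ b ≠ 0) ∧ MvPolynomial.eval ![a, b] (MvPolynomial.map (residue S) Ψ) = 0 :=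
  exists_eval_eq_zero_of_isAlgClosed hd (hΨ.map (residue S))

/-- Conversely, where the clause HOLDS the residue field carries a rootless polynomial of degree `d`: the last conjunct of
`ArithBinaryResidueAt` at a stage with residue field `κ_i` gives `HasRootlessPoly κ_i d`. [folklore] -/
theorem hasRootlessPoly_residueField_of_forall (S : Type u) [CommRing S] [IsLocalRing S] {d : ℕ}
    {Ψ : MvPolynomial (Fin 2) S} (hΨ : Ψ.IsHomogeneous d)
    (h : ∀ a b : ResidueField S, (a ≠ 0 ∨ b ≠ 0) → MvPolynomial.eval ![a, b] (MvPolynomial.map (residue S) Ψ) ≠ 0) :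
    HasRootlessPoly (ResidueField S) d :=
  hasRootlessPoly_of_forall_eval_ne_zero (hΨ.map (residue S)) h

/-! ## 4. Linear factors give zeros; an `𝔽₂` binary cubic without zeros -/

section Linear

variable {κ : Type u} [Field κ]

/-- **A binary form with the `κ`-linear factor `α X₀ + β X₁ ≠ 0` vanishes at `(β, −α) ≠ (0, 0)`**; hence «no zero on `κ² ∖ 0`»
implies «no `κ`-linear factor». [folklore] -/
theorem eval_eq_zero_of_linear_dvd {Ψ : MvPolynomial (Fin 2) κ} {α β : κ} (hαβ : α ≠ 0 ∨ β ≠ 0)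
    (hdvd : (MvPolynomial.C α * MvPolynomial.X 0 + MvPolynomial.C β * MvPolynomial.X 1) ∣ Ψ) :
    (β ≠ 0 ∨ -α ≠ 0) ∧ MvPolynomial.eval ![β, -α] Ψ = 0 := by
  refine ⟨hαβ.symm.imp id neg_ne_zero.mpr, ?_⟩
  obtain ⟨G, rfl⟩ := hdvd
  rw [MvPolynomial.eval_mul]
  simp only [map_add, map_mul, MvPolynomial.eval_C, MvPolynomial.eval_X, Matrix.cons_val_zero, Matrix.cons_val_one]
  ring

/-- Hence a binary form with no zero on `κ² ∖ 0` has no `κ`-linear factor. [folklore] -/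
theorem not_linear_dvd_of_forall_eval_ne_zero {Ψ : MvPolynomial (Fin 2) κ}
    (h : ∀ a b : κ, (a ≠ 0 ∨ b ≠ 0) → MvPolynomial.eval ![a, b] Ψ ≠ 0) {α β : κ} (hαβ : α ≠ 0 ∨ β ≠ 0) :
    ¬ (MvPolynomial.C α * MvPolynomial.X 0 + MvPolynomial.C β * MvPolynomial.X 1) ∣ Ψ := fun hdvd => by
  obtain ⟨hne, h0⟩ := eval_eq_zero_of_linear_dvd hαβ hdvd
  exact h β (-α) hne h0

/-- A binary form of degree `d` with vanishing `X₀^d`-coefficient is divisible by `X₁`. [folklore] -/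
theorem X_one_dvd_of_coeff_eq_zero {Ψ : MvPolynomial (Fin 2) κ} {d : ℕ} (hΨ : Ψ.IsHomogeneous d)
    (h : Ψ.coeff (lineExp d d) = 0) : MvPolynomial.X 1 ∣ Ψ := by
  classical
  have hmem : Ψ ∈ Ideal.span (MvPolynomial.X '' ({1} : Set (Fin 2)) : Set (MvPolynomial (Fin 2) κ)) := by
    rw [MvPolynomial.mem_ideal_span_X_image]
    intro m hm
    refine ⟨1, rfl, fun h1 => ?_⟩
    have hdeg : m 0 + m 1 = d := by
      rw [← weight_one_fin_two]; exact hΨ (MvPolynomial.mem_support_iff.mp hm)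
    obtain ⟨-, heq⟩ := eq_lineExp_of_degree hdeg
    have hm0 : m 0 = d := by omega
    rw [hm0] at heq
    rw [heq] at hm
    exact (MvPolynomial.mem_support_iff.mp hm) h
  rw [Set.image_singleton, Ideal.mem_span_singleton'] at hmem
  obtain ⟨G, hG⟩ := hmem
  exact ⟨G, by rw [← hG, mul_comm]⟩

/-- A binary form of degree `d` with vanishing `X₁^d`-coefficient is divisible by `X₀`. [folklore] -/
theorem X_zero_dvd_of_coeff_eq_zero {Ψ : MvPolynomial (Fin 2) κ} {d : ℕ} (hΨ : Ψ.IsHomogeneous d)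
    (h : Ψ.coeff (lineExp d 0) = 0) : MvPolynomial.X 0 ∣ Ψ := by
  classical
  have hmem : Ψ ∈ Ideal.span (MvPolynomial.X '' ({0} : Set (Fin 2)) : Set (MvPolynomial (Fin 2) κ)) := by
    rw [MvPolynomial.mem_ideal_span_X_image]
    intro m hm
    refine ⟨0, rfl, fun h0 => ?_⟩
    have hdeg : m 0 + m 1 = d := by
      rw [← weight_one_fin_two]; exact hΨ (MvPolynomial.mem_support_iff.mp hm)
    obtain ⟨-, heq⟩ := eq_lineExp_of_degree hdeg
    rw [h0] at heq
    rw [heq] at hm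
    exact (MvPolynomial.mem_support_iff.mp hm) h
  rw [Set.image_singleton, Ideal.mem_span_singleton'] at hmem
  obtain ⟨G, hG⟩ := hmem
  exact ⟨G, by rw [← hG, mul_comm]⟩

/-- **Factor theorem for binary forms**: a zero `(a, b) ≠ (0, 0)` of a binary form `Ψ` of degree `d` over a field gives the
`κ`-linear factor `b X₀ − a X₁` of `Ψ` (case `b = 0`: the `X₀^d`-coefficient vanishes and `X₁ ∣ Ψ`; case `b ≠ 0`: after the invertible
linear change `X₀ ↦ X₀ + a X₁`, `X₁ ↦ b X₁` the zero sits at `(0, 1)`, the `X₁^d`-coefficient vanishes and `X₀` divides). Hence for binary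
forms «no `κ`-linear factor» ⟺ «no zero on `κ² ∖ 0`». [folklore] -/
theorem linear_dvd_of_eval_eq_zero {Ψ : MvPolynomial (Fin 2) κ} {d : ℕ} (hΨ : Ψ.IsHomogeneous d) {a b : κ}
    (hab : a ≠ 0 ∨ b ≠ 0) (h0 : MvPolynomial.eval ![a, b] Ψ = 0) :
    (MvPolynomial.C b * MvPolynomial.X 0 + MvPolynomial.C (-a) * MvPolynomial.X 1) ∣ Ψ := by
  rcases eq_or_ne b 0 with rfl | hb
  · -- `b = 0`, `a ≠ 0`: `Ψ(a, 0) = coeff_{X₀^d} · a^d = 0`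
    have ha : a ≠ 0 := hab.resolve_right (not_not.mpr rfl)
    have hc : Ψ.coeff (lineExp d d) = 0 := by
      have h1 := eval_left_of_isHomogeneous hΨ a
      rw [h0] at h1
      exact (mul_eq_zero.mp h1.symm).resolve_right (pow_ne_zero d ha)
    obtain ⟨G, hG⟩ := X_one_dvd_of_coeff_eq_zero hΨ hc
    refine ⟨MvPolynomial.C (-a)⁻¹ * G, ?_⟩
    have hna : (-a) ≠ 0 := neg_ne_zero.mpr ha
    have h1 : MvPolynomial.C (-a) * MvPolynomial.C (-a)⁻¹ = (1 : MvPolynomial (Fin 2) κ) := by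
      rw [← map_mul, mul_inv_cancel₀ hna, map_one]
    rw [hG, map_zero, zero_mul, zero_add]
    linear_combination (-(MvPolynomial.X 1 * G)) * h1
  · -- `b ≠ 0`: move the zero to `(0, 1)` by `θ : X₀ ↦ X₀ + a X₁, X₁ ↦ b X₁`, inverse `θ' : X₀ ↦ X₀ − (a/b) X₁, X₁ ↦ b⁻¹ X₁`
    let g : Fin 2 → MvPolynomial (Fin 2) κ :=
      ![MvPolynomial.X 0 + MvPolynomial.C a * MvPolynomial.X 1, MvPolynomial.C b * MvPolynomial.X 1]
    let g' : Fin 2 → MvPolynomial (Fin 2) κ :=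
      ![MvPolynomial.X 0 - MvPolynomial.C (a * b⁻¹) * MvPolynomial.X 1, MvPolynomial.C b⁻¹ * MvPolynomial.X 1]
    have hb1 : MvPolynomial.C b * MvPolynomial.C b⁻¹ = (1 : MvPolynomial (Fin 2) κ) := by
      rw [← map_mul, mul_inv_cancel₀ hb, map_one]
    have hinv : (MvPolynomial.aeval g').comp (MvPolynomial.aeval g) = AlgHom.id κ (MvPolynomial (Fin 2) κ) := by
      refine MvPolynomial.algHom_ext fun i => ?_
      fin_cases i
      · simp only [AlgHom.comp_apply, AlgHom.id_apply, MvPolynomial.aeval_X, g, g', Matrix.cons_val_zero, Matrix.cons_val_one,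
          map_add, map_mul, MvPolynomial.algHom_C, MvPolynomial.algebraMap_eq, Fin.zero_eta, Fin.isValue]
        ring
      · simp only [AlgHom.comp_apply, AlgHom.id_apply, MvPolynomial.aeval_X, g, g', Matrix.cons_val_one, map_mul,
          MvPolynomial.algHom_C, MvPolynomial.algebraMap_eq, Fin.mk_one, Fin.isValue, Matrix.cons_val_fin_one]
        linear_combination (MvPolynomial.X 1) * hb1
    -- `θ Ψ` is a form of degree `d` vanishing at `(0, 1)`
    have hΨ' : (MvPolynomial.aeval g Ψ).IsHomogeneous d := by
      have h1 := hΨ.aeval g (n := 1) (fun i => by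
        fin_cases i
        · exact (MvPolynomial.isHomogeneous_X κ 0).add (MvPolynomial.isHomogeneous_C_mul_X a 1)
        · exact MvPolynomial.isHomogeneous_C_mul_X b 1)
      simpa using h1
    have hev : MvPolynomial.eval ![(0 : κ), 1] (MvPolynomial.aeval g Ψ) = 0 := by
      have hfun : (fun i => MvPolynomial.aeval ![(0 : κ), 1] (g i)) = ![a, b] := by
        funext i
        fin_cases i <;> simp [g]
      -- `eval x = aeval x` on `MvPolynomial σ κ` over `κ` (Mathlib `coe_aeval_eq_eval`, definitional)
      change MvPolynomial.aeval ![(0 : κ), 1] (MvPolynomial.aeval g Ψ) = 0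
      rw [← AlgHom.comp_apply, MvPolynomial.comp_aeval, hfun]
      exact h0
    have hc : (MvPolynomial.aeval g Ψ).coeff (lineExp d 0) = 0 := by
      have h1 := eval_right_of_isHomogeneous hΨ' 1
      rwa [hev, one_pow, mul_one, eq_comm] at h1
    obtain ⟨G', hG'⟩ := X_zero_dvd_of_coeff_eq_zero hΨ' hc
    -- pull back along `θ'`
    have hback : Ψ = MvPolynomial.aeval g' (MvPolynomial.aeval g Ψ) := by
      rw [← AlgHom.comp_apply, hinv, AlgHom.id_apply]
    have hX : MvPolynomial.aeval g' (MvPolynomial.X 0 : MvPolynomial (Fin 2) κ) =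
        MvPolynomial.X 0 - MvPolynomial.C (a * b⁻¹) * MvPolynomial.X 1 := by
      simp [g']
    refine ⟨MvPolynomial.C b⁻¹ * MvPolynomial.aeval g' G', ?_⟩
    rw [hback, hG', map_mul, hX, map_mul, map_neg]
    linear_combination (-(MvPolynomial.X 0 * MvPolynomial.aeval g' G')) * hb1

/-- Contrapositive packaging: **a binary form of degree `d` with NO `κ`-linear factor has NO zero on `κ² ∖ 0`**, hence (with
`hasRootlessPoly_of_forall_eval_ne_zero`) yields `HasRootlessPoly κ d` — RULING 115a's «binary d-form without κ-linear factor ⇒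
`HasRootlessPoly κ d`». «No linear factor» is read as: no `α X₀ + β X₁` with `(α, β) ≠ (0, 0)` divides `Ψ`. [folklore] -/
theorem forall_eval_ne_zero_of_forall_not_linear_dvd {Ψ : MvPolynomial (Fin 2) κ} {d : ℕ} (hΨ : Ψ.IsHomogeneous d)
    (h : ∀ α β : κ, (α ≠ 0 ∨ β ≠ 0) → ¬ (MvPolynomial.C α * MvPolynomial.X 0 + MvPolynomial.C β * MvPolynomial.X 1) ∣ Ψ) :
    ∀ a b : κ, (a ≠ 0 ∨ b ≠ 0) → MvPolynomial.eval ![a, b] Ψ ≠ 0 := fun a b hab h0 =>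
  h b (-a) (hab.symm.imp id neg_ne_zero.mpr) (linear_dvd_of_eval_eq_zero hΨ hab h0)

/-- **RULING 115a verbatim: a binary form of degree `d` over `κ` with no `κ`-linear factor gives `HasRootlessPoly κ d`.** [folklore] -/
theorem hasRootlessPoly_of_forall_not_linear_dvd {Ψ : MvPolynomial (Fin 2) κ} {d : ℕ} (hΨ : Ψ.IsHomogeneous d)
    (h : ∀ α β : κ, (α ≠ 0 ∨ β ≠ 0) → ¬ (MvPolynomial.C α * MvPolynomial.X 0 + MvPolynomial.C β * MvPolynomial.X 1) ∣ Ψ) :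
    HasRootlessPoly κ d :=
  hasRootlessPoly_of_forall_eval_ne_zero hΨ (forall_eval_ne_zero_of_forall_not_linear_dvd hΨ h)

/-- **Over an algebraically closed field every binary form of degree `d ≥ 1` HAS a `κ`-linear factor** (RULING 115a's second sentence).
[folklore] -/
theorem exists_linear_dvd_of_isAlgClosed [IsAlgClosed κ] {d : ℕ} (hd : 1 ≤ d) {Ψ : MvPolynomial (Fin 2) κ}
    (hΨ : Ψ.IsHomogeneous d) :
    ∃ α β : κ, (α ≠ 0 ∨ β ≠ 0) ∧ (MvPolynomial.C α * MvPolynomial.X 0 + MvPolynomial.C β * MvPolynomial.X 1) ∣ Ψ := by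
  obtain ⟨a, b, hab, h0⟩ := exists_eval_eq_zero_of_isAlgClosed hd hΨ
  exact ⟨b, -a, hab.symm.imp id neg_ne_zero.mpr, linear_dvd_of_eval_eq_zero hΨ hab h0⟩

end Linear

/-- **Over `𝔽₂` the binary cubic `X₀³ + X₀ X₁² + X₁³` has no zero on `𝔽₂² ∖ 0`** (tri-1's toy b5): the last conjunct of the A7 clause is
satisfiable in degree `3` over a non-closed residue field — the residue is genuinely ARITHMETIC. [folklore] -/
theorem exists_forall_eval_ne_zero_zmod2_three :
    ∃ Ψ : MvPolynomial (Fin 2) (ZMod 2), Ψ.IsHomogeneous 3 ∧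
      ∀ a b : ZMod 2, (a ≠ 0 ∨ b ≠ 0) → MvPolynomial.eval ![a, b] Ψ ≠ 0 := by
  refine ⟨MvPolynomial.X 0 ^ 3 + MvPolynomial.X 0 * MvPolynomial.X 1 ^ 2 + MvPolynomial.X 1 ^ 3, ?_, ?_⟩
  · exact (((MvPolynomial.isHomogeneous_X (ZMod 2) (0 : Fin 2)).pow 3).add
      ((MvPolynomial.isHomogeneous_X (ZMod 2) (0 : Fin 2)).mul ((MvPolynomial.isHomogeneous_X (ZMod 2) (1 : Fin 2)).pow 2))).add
      ((MvPolynomial.isHomogeneous_X (ZMod 2) (1 : Fin 2)).pow 3)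
  · intro a b hab
    simp only [map_add, map_mul, map_pow, MvPolynomial.eval_X, Matrix.cons_val_zero, Matrix.cons_val_one]
    revert hab
    revert a b
    decide

end Summit.ResolutionOfSingularities.ResolutionOfSingularities.Theorems.SwitchingDichotomy.ArithResidue

end
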